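import Summits.MatrixMultiplication.OmegaCensus.DominoZpZpCover
import HarnessLib

/-!
# Margin-pruned kernel enumeration on `ZMod p × ZMod p` with DIRECTION-TAGGED codes (three-set cells)

ω-census `pub-omega`, family (b3), seat pub-omega-group gen 36.  Framing: lottery ticket; floor = certified bounds/negative
ranges.  VALUE: the bridge from the generic row enumerator `ZpZpDomino.coverGen` (gen 20) to cover statements whose
"certified" predicate depends on the DIRECTION (and, through the caller, on the hole position) — as needed by the three-set
cube cells, where the part `W = {0, e₁, e₂}` has a different line image in each direction; NOT progress on ω.

* `off p B j = j·B^p` and `offs p B` — the accumulated code of direction `j` starts at `off p B j`, so ONE search tree of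
  naturals can flag (direction, count vector) pairs: code `j·B^p + polyBE B c`.
* `cover3 p d tree` — `coverGen` over ALL row-sum vectors (no `GL₂` normal form: the symmetry is spent on `W`), rows from
  `compsLB []`, initial accumulators `offs p (d+1)`.
* `getD_accsAfter_rowsOf_init` — the accumulated code of direction `j` is `init[j] + Σ_i g i · B^{p−1−pv j i}` for any
  initial vector of length `p + 1` (gen 20 proved the case `init = 0`).
* **`exists_unflagged_of_cover3`** — if `cover3 p d tree = true` then every `g : Fin (p²) → ℕ` of sum `d` has a direction
  `j ≤ p` whose tagged code `off p (d+1) j + polyBE (d+1) (cnts p j g)` is NOT flagged by `tree`.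
* `soundChk3 p d tree cert` (`Bool`) and **`exists_cert_of_cover3`** — if moreover every unflagged tagged code of a
  composition is `cert`-ified (an arbitrary `Bool` predicate on (direction, count vector), decided per table by the caller),
  then some direction `j ≤ p` has `cert j (cnts p j g) = true`.
Nothing about `tree` is trusted.  Instances: `ThreeSetZ5Z5Cover6*.lean` (`p = 5`, parts `3` and `6`).
-/

namespace Summit.MatrixMultiplication.OmegaCensus

open Finset

namespace ZpZpDomino

/-! ## Direction offsets and the program -/

/-- Offset of direction `j`: `j · B^p` (codes of count vectors are `< B^p`). [folklore] -/
def off (p B j : ℕ) : ℕ := j * B ^ p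

/-- The initial accumulators: the offsets of the `p + 1` directions. [folklore] -/
def offs (p B : ℕ) : List ℕ := (List.range (p + 1)).map fun j => off p B j

/-- Length of `offs`. [folklore] -/
@[simp] theorem length_offs (p B : ℕ) : (offs p B).length = p + 1 := by simp [offs]

/-- Entries of `offs`. [folklore] -/
theorem getD_offs (p B : ℕ) {j : ℕ} (hj : j < p + 1) : (offs p B).getD j 0 = off p B j := by
  simp [offs, List.getD_eq_getElem?_getD, List.getElem?_range hj]

/-- `off p B 0 = 0`: direction `0` (row sums) is untagged, matching `coverGen`'s row-sum shortcut. [folklore] -/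
@[simp] theorem off_zero (p B : ℕ) : off p B 0 = 0 := by simp [off]

/-- **The three-set cover program**: `coverGen` over all row-sum vectors of sum `d`, unrestricted rows, tagged initial
accumulators. [folklore] -/
def cover3 (p d : ℕ) (tree : BTree) : Bool :=
  coverGen tree (d + 1) (rowWs p (d + 1)) (compsLB [] p d) (List.replicate p (tabOf [] p d)) (offs p (d + 1))

/-- **Soundness check** (`Bool`): every composition `c` of `d` into `p` parts and direction `j ≤ p` whose tagged code is NOT
flagged by `tree` satisfies `cert j c`. [folklore] -/
def soundChk3 (p d : ℕ) (tree : BTree) (cert : ℕ → List ℕ → Bool) : Bool :=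
  (List.range (p + 1)).all fun j => (compsLB [] p d).all fun c =>
    tree.mem (off p (d + 1) j + polyBE (d + 1) c) || cert j c

/-! ## Semantics -/

section Semantic

variable {p : ℕ} [NeZero p]

omit [NeZero p] in
/-- **The code of direction `j` accumulated over the rows of `g`, arbitrary initial accumulators.** [folklore] -/
theorem getD_accsAfter_rowsOf_init (B : ℕ) (g : Fin (p * p) → ℕ) (init : List ℕ) (hinit : init.length = p + 1)
    {j : ℕ} (hj : j < p + 1) :
    (accsAfter (rowWs p B) init (rowsOf g)).getD j 0 = init.getD j 0 + ∑ i, g i * B ^ (p - 1 - pv p j i.val) := by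
  have hws : ∀ (acc : List ℕ), acc.length = p + 1 → ∀ w ∈ rowWs p B, ∀ x ∈ w, x.length = acc.length := by
    intro acc hacc w hw x hx
    simp only [rowWs, List.mem_map, List.mem_range] at hw
    obtain ⟨t, -, rfl⟩ := hw
    simp only [rowW, List.mem_map, List.mem_range] at hx
    obtain ⟨u, -, rfl⟩ := hx
    simp [hacc]
  have hwl : ∀ t < (rowsOf g).length, ((rowWs p B).getD t []).length = ((rowsOf g).getD t []).length := fun t ht => by
    rw [length_rowsOf] at ht
    rw [getD_rowWs p B ht, getD_rowsOf g ht, length_rowW, List.length_ofFn]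
  have e1 := getD_accsAfter (rowWs p B) init (rowsOf g) (hws init hinit) (by simp) hwl (by rw [hinit]; exact hj)
  have e0 := getD_accsAfter (rowWs p B) (List.replicate (p + 1) 0) (rowsOf g) (hws _ (by simp)) (by simp) hwl
    (by simpa using hj)
  have e0' := getD_accsAfter_rowsOf B g hj
  rw [e0, List.getD_eq_getElem _ _ (by simpa using hj), List.getElem_replicate, zero_add] at e0'
  rw [e1, e0']

/-- **From the three-set cover program to an unflagged tagged code.** [folklore] -/
theorem exists_unflagged_of_cover3 {d : ℕ} (tree : BTree) (h : cover3 p d tree = true)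
    (g : Fin (p * p) → ℕ) (hg : ∑ i, g i = d) :
    ∃ j < p + 1, tree.mem (off p (d + 1) j + polyBE (d + 1) (cnts p j g)) = false := by
  have hp0 : 0 < p := Nat.pos_of_ne_zero (NeZero.ne p)
  -- the row-sum vector is a candidate
  have hRlen : (rowSums g).length = p := length_rowSums g
  have hRsum : (rowSums g).sum = d := by rw [sum_rowSums, hg]
  have hRmem : rowSums g ∈ compsLB [] p d := mem_compsLB [] p d _ hRlen hRsum fun k _ => by simp
  have hRle : ∀ t < p, (rowSums g).getD t 0 < d + 1 := fun t ht => by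
    have : (rowSums g).getD t 0 ≤ (rowSums g).sum := by
      rw [List.getD_eq_getElem _ _ (by rw [hRlen]; exact ht)]
      exact List.le_sum_of_mem (List.getElem_mem _)
    omega
  have htabs : (List.replicate p (tabOf [] p d)).length = p := by simp
  rcases coverGen_spec h (by rw [htabs, length_rowWs]) _ hRmem (by rw [htabs, hRlen]) with hR | hM
  · exact ⟨0, by omega, by rw [cnts_zero_eq_rowSums, off_zero, zero_add]; exact hR⟩
  · -- every row of `g` is in the unrestricted composition table
    have hrows : ∀ t < (rowSums g).length,
        (rowsOf g).getD t [] ∈ ((List.replicate p (tabOf [] p d)).getD t []).getD ((rowSums g).getD t 0) [] := by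
      intro t ht
      rw [hRlen] at ht
      rw [List.getD_eq_getElem (List.replicate p (tabOf [] p d)) [] (by simpa using ht), List.getElem_replicate,
        getD_tabOf [] p d (hRle t ht), getD_rowsOf g ht]
      exact mem_compsLB [] p _ _ (List.length_ofFn) (by rw [List.sum_ofFn, getD_rowSums g ht]) fun k hk => by simp
    have hany := hM (rowsOf g) (by rw [length_rowsOf, hRlen]) hrows
    rw [List.any_eq_true] at hany
    obtain ⟨a, ha, hfa⟩ := hany
    obtain ⟨j, hj, rfl⟩ := List.getElem_of_mem ha
    have hws : ∀ w ∈ rowWs p (d + 1), ∀ x ∈ w, x.length = (offs p (d + 1)).length := by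
      intro w hw x hx
      simp only [rowWs, List.mem_map, List.mem_range] at hw
      obtain ⟨t, -, rfl⟩ := hw
      simp only [rowW, List.mem_map, List.mem_range] at hx
      obtain ⟨u, -, rfl⟩ := hx
      simp
    have hlen : (accsAfter (rowWs p (d + 1)) (offs p (d + 1)) (rowsOf g)).length = p + 1 := by
      rw [length_accsAfter _ _ _ hws, length_offs]
    have hj' : j < p + 1 := by rw [← hlen]; exact hj
    refine ⟨j, hj', ?_⟩
    have e := getD_accsAfter_rowsOf_init (d + 1) g (offs p (d + 1)) (length_offs _ _) hj'
    rw [List.getD_eq_getElem _ _ hj, getD_offs _ _ hj', code_eq_polyBE] at e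
    rw [← e]
    simpa using hfa

/-- **From the cover program and the soundness check to a certified direction.**  `cert` is an arbitrary `Bool` predicate on
(direction, count vector); the caller decides `soundChk3` per table and hole position. [folklore] -/
theorem exists_cert_of_cover3 {d : ℕ} (tree : BTree) (cert : ℕ → List ℕ → Bool)
    (hs : soundChk3 p d tree cert = true) (h : cover3 p d tree = true)
    (g : Fin (p * p) → ℕ) (hg : ∑ i, g i = d) :
    ∃ j < p + 1, cert j (cnts p j g) = true := by
  obtain ⟨j, hj, hmem⟩ := exists_unflagged_of_cover3 tree h g hg
  refine ⟨j, hj, ?_⟩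
  simp only [soundChk3, List.all_eq_true, List.mem_range] at hs
  have h1 := hs j hj (cnts p j g) (hg ▸ cnts_mem_compsLB j g)
  rw [hmem, Bool.false_or] at h1
  exact h1

omit [NeZero p] in
/-- Entries of a count vector: `(cnts p j g)[v] = Σ_i pick v (pv p j i) (g i)`. [folklore] -/
theorem getD_cnts (j : ℕ) (g : Fin (p * p) → ℕ) {v : ℕ} (hv : v < p) :
    (cnts p j g).getD v 0 = ∑ i : Fin (p * p), pick v (pv p j i.val) (g i) := by
  rw [cnts, Literature.Computability.Complexity.getD_ofFn _ _ hv]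

end Semantic

end ZpZpDomino

end Summit.MatrixMultiplication.OmegaCensus
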